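import Summits.BirchSwinnertonDyer.Rank1Residual.ManinAdditive.ShimuraCuspLifting
import Summits.BirchSwinnertonDyer.BirchSwinnertonDyer.Theorems.ManinLocalTwoThreeNoRationalTwoTorsion
import Summits.BirchSwinnertonDyer.BirchSwinnertonDyer.Theorems.ManinLocalTwoThreeGammaOneIndexFour
import Literature.NumberTheory.EllipticCurves.ModPReducibilityAlmostAllProofs
import Literature.NumberTheory.EllipticCurves.ModTwoReducibleIffTwoTorsionRoot
import Literature.NumberTheory.EllipticCurves.ModThreeReducibleIffPsi3Root
import Literature.NumberTheory.EllipticCurves.ShimuraSubgroupEisensteinProofs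
import Literature.NumberTheory.EllipticCurves.ShimuraSubgroupHeckeCongruence
import Literature.NumberTheory.EllipticCurves.CuspFormLFunctionLevelConductorProofs
import Literature.NumberTheory.EllipticCurves.LFunctionPrimeCoeff
import HarnessLib

/-!
# The Shimura-cover kernel `Λ₀(f)/Λ₁(f)` is supported on the REDUCIBLE primes of `E`; E-an-128₂ IS A THEOREM

Summit `BirchSwinnertonDyer`, route `ManinLocalTwoThree` (cell bsd-f2-manin), crux C2 `ManinOddAtFour`
(stmt-BirchSwinnertonDyer-22967; bears also on C3 stmt-BirchSwinnertonDyer-22968).  Prover seat bsd-line-manin23-p1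
(C2/C3 LEAD), gen 9.

For the newform `f ∈ S₂(Γ₀(N))` of an elliptic curve `W/ℚ` (`IsNewformOf W f`, any level `N`, no optimality
hypothesis) and ANY prime `p`:

* **`shimuraIndexPrimeTo_of_hasIrreducibleModPGaloisRep`** — if `W[p]` is an irreducible `Γ_ℚ`-module then
  `ShimuraIndexPrimeTo p f`: the quotient `Λ₀(f)/Λ₁(f)` (kernel of the Shimura cover `ℂ/Λ₁(f) → ℂ/Λ₀(f)`,
  `Λ₁ = periodLatticeGamma1`, `Λ₀ = periodLattice`) has no element of order `p`.
  MECHANISM (no «`Σ(N)` is of μ-type» dictionary, which the tree does not have): Ribet's EISENSTEIN property of the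
  Shimura subgroup in the tree's lattice form `sub_sub_mul_mem_periodLatticeGamma1_of_isNewform0`
  (`(a_ℓ(f) − ℓ − 1)·Λ₀(f) ⊆ Λ₁(f)` for every prime `ℓ ∤ N`) + the tree's Chebotarev/Brauer–Nesbitt consequence
  `exists_prime_notMem_not_dvd_frobeniusTrace_sub` (`W[p]` irreducible ⟹ outside any finite set there is a good
  prime `ℓ` with `p ∤ a_ℓ(W) − ℓ − 1`) + `a_ℓ(f) = a_ℓ(W)` (`IsNewformOf`, `LFunction_apply_prime_eq_frobeniusTrace`)
  + Bézout (`p·x ∈ Λ₁`, `m·x ∈ Λ₁`, `p ∤ m` ⟹ `x ∈ Λ₁`).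
* `plusIndexPrimeTo_of_hasIrreducibleModPGaloisRep` — hence `PlusIndexPrimeTo p f` (tree
  `plusIndexPrimeTo_of_shimuraIndexPrimeTo`).
* **`shimuraTwoForcesRationalTwoTorsion_holds : ShimuraTwoForcesRationalTwoTorsion`** — an's law **E-an-128₂**
  (`…/ManinAdditive/ShimuraCuspLifting.lean` §5, `@[conjecture]`) BY NAME: `2 ∣ [Λ₀ : Λ₁]` forces a rational root
  of the `2`-division cubic (`W[2]` reducible ⟺ rational `2`-torsion, tree
  `not_hasIrreducibleModPGaloisRep_two_iff_exists_isRoot_twoTorsionPolynomial`).  The optimality binder of the law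
  is not used.  Consequences with their E-an-128₂ hypothesis DISCHARGED: `plusIndexPrimeTo_two_of_noRationalTwoTorsion'`,
  `twoAdicPolarWitness_of_noRationalTwoTorsion'` (modulo E-es-66₂ only), and p3's TURNKEY-an-15
  `not_two_dvd_maninConstant_of_noRationalTwoTorsion'` (modulo modularity, the Kato fact, `KatoCurveExists`, E-es-66₂).
* `plusIndexPrimeTo_three_of_forall_not_isRoot_Ψ₃` — at `p = 3`: no rational root of `Ψ₃` (⟺ `W[3]` irreducible,
  tree `hasIrreducibleModPGaloisRep_three_iff_forall_not_isRoot_Ψ₃`) ⟹ `PlusIndexPrimeTo 3 f` — the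
  `W[3]`-irreducible part of es's E-es-67 at EVERY level (no `9 ∣ N`).
* **`periodLatticeGamma1_eq_periodLattice_of_sq_dvd_of_hasIrreducibleModPGaloisRep`** — at a level with
  `p² ∣ N` (`a_p(f) = 0`, Atkin–Lehner; `p·Λ₀ ⊆ Λ₁`, Ling–Oesterlé Thm. 6 in the tree's form
  `pMulLatticeLeGamma1OfTracelessPrime_holds`) and `W[p]` irreducible the Shimura cover is TRIVIAL: `Λ₁(f) = Λ₀(f)`;
  in particular at `4 ∣ N` without rational `2`-torsion, and at `9 ∣ N` without a rational root of `Ψ₃`; then an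
  optimal `X₁(N)`-datum on the same newform has `|c₁| = |c₀|` (tree `natAbs_maninConstant₀_eq_of_periodLatticeGamma1_eq_periodLattice`).

HONEST FRAMING: these are unconditional tree theorems (standard axioms), but they concern the IRREDUCIBLE-`W[p]` locus,
where both crux lines already close modulo Kato's fact; the crux stubs of C2 v13 / C3 v17 (reducible residuals, cuspidal
Kummer laws, Kato facts, ČNS) are NOT narrowed.  E-an-128 / 128ℓ / 128♭ / 128₄ (rational ℓ-TORSION POINTS, prime powers)
are NOT proved here: for odd `ℓ` the Eisenstein route only gives reducibility of `W[ℓ]`.  C2 `ManinOddAtFour`, C3, Manin's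
conjecture and BSD are NOT proved by this file.  No definitions, no named facts, no sorry.

References: K. Ribet, Sém. Th. Nombres Bordeaux 1987–88, exp. 6, Thm. 1 [Ribet1988Shimura]; S. Ling, J. Oesterlé,
Astérisque 196–197 (1991) Thm. 1, Thm. 6 [LingOesterle1991]; H. Darmon, F. Diamond, R. Taylor, *Fermat's Last Theorem*
(1995) Prop. 2.6 (b) [DarmonDiamondTaylor1995]; V. Vatsal, J. Inst. Math. Jussieu 4 (2005) Rem. 1.8 [Vatsal2005];
A. Atkin, J. Lehner, Math. Ann. 185 (1970) Thm. 3 [AtkinLehner1970].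
-/

set_option autoImplicit false
set_option linter.dupNamespace false

noncomputable section

open scoped Classical MatrixGroups ModularForm

open CongruenceSubgroup Complex WeierstrassCurve Literature.NumberTheory.EllipticCurves
  Literature.NumberTheory.EllipticCurves.ModularForms
open Summit.BirchSwinnertonDyer.Rank1Residual.ManinAdditive.KatoCurve
  Summit.BirchSwinnertonDyer.Rank1Residual.ManinAdditive.CuspidalKummer

namespace Summit.BirchSwinnertonDyer.BirchSwinnertonDyer.Theorems.ManinLocalTwoThree

/-! ### §1. Bézout in an additive subgroup of `ℂ` -/

/-- If `m·z ∈ S` and `p·z ∈ S` for an additive subgroup `S ⊆ ℂ`, an integer `m` and a prime `p ∤ m`, then `z ∈ S`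
(`1 = a p + b m`). [folklore] -/
theorem mem_of_intCast_mul_mem_of_prime_mul_mem {S : AddSubgroup ℂ} {p : ℕ} (hp : p.Prime) {m : ℤ}
    (hm : ¬ (p : ℤ) ∣ m) {z : ℂ} (hmz : (m : ℂ) * z ∈ S) (hpz : (p : ℂ) * z ∈ S) : z ∈ S := by
  have hcop : IsCoprime (p : ℤ) m := (Nat.prime_iff_prime_int.mp hp).irreducible.coprime_iff_not_dvd.mpr hm
  obtain ⟨a, b, hab⟩ := hcop
  have ha : (a : ℂ) * ((p : ℂ) * z) ∈ S := by
    rw [← zsmul_eq_mul]; exact S.zsmul_mem hpz a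
  have hb : (b : ℂ) * ((m : ℂ) * z) ∈ S := by
    rw [← zsmul_eq_mul]; exact S.zsmul_mem hmz b
  have hz : z = (a : ℂ) * ((p : ℂ) * z) + (b : ℂ) * ((m : ℂ) * z) := by
    have h1 : (a : ℂ) * (p : ℂ) + (b : ℂ) * (m : ℂ) = 1 := by exact_mod_cast hab
    linear_combination (-z) * h1
  rw [hz]
  exact S.add_mem ha hb

/-! ### §2. `W[p]` irreducible ⟹ `p ∤ [Λ₀(f) : Λ₁(f)]` (every prime `p`, every level) -/

section Irreducible

variable (W : WeierstrassCurve ℚ) [W.IsElliptic] [W.IsGloballyMinimal] {N : ℕ} [NeZero N]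

/-- **The Shimura-cover kernel is supported on the reducible primes.**  For the newform `f` of an elliptic curve
`W/ℚ` (any level `N`) and a prime `p` with `W[p]` an IRREDUCIBLE `Γ_ℚ`-module, `Λ₀(f)/Λ₁(f)` has no element of
order `p` (`ShimuraIndexPrimeTo p f`).  Proof: pick (Chebotarev, tree `exists_prime_notMem_not_dvd_frobeniusTrace_sub`)
a good prime `ℓ ∤ N` with `p ∤ a_ℓ(W) − ℓ − 1`; the Eisenstein number `a_ℓ(f) − ℓ − 1 = a_ℓ(W) − ℓ − 1` kills
`Λ₀(f)/Λ₁(f)` (Ribet, tree `sub_sub_mul_mem_periodLatticeGamma1_of_isNewform0`); Bézout with `p·x ∈ Λ₁(f)`.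
[cite: Ribet1988Shimura, Thm. 1 and §3] [cite: DarmonDiamondTaylor1995, Prop. 2.6 (b)] -/
theorem shimuraIndexPrimeTo_of_hasIrreducibleModPGaloisRep {f : CuspForm (Gamma0 N) 2} (hf : IsNewformOf W f)
    {p : ℕ} (hp : p.Prime) (hirr : W.HasIrreducibleModPGaloisRep p) : ShimuraIndexPrimeTo p f := by
  haveI : Fact p.Prime := ⟨hp⟩
  intro x hx hpx
  obtain ⟨ℓ, hℓ, hℓS, _hℓp, hgood, hnot⟩ := exists_prime_notMem_not_dvd_frobeniusTrace_sub W p hirr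
    (↑N.primeFactors : Set ℕ) N.primeFactors.finite_toSet
  have hℓN : ¬ ℓ ∣ N := fun h ↦
    hℓS (Finset.mem_coe.mpr (Nat.mem_primeFactors.mpr ⟨hℓ.out, h, NeZero.ne N⟩))
  haveI : NeZero ℓ := ⟨hℓ.out.ne_zero⟩
  have hE := sub_sub_mul_mem_periodLatticeGamma1_of_isNewform0 f hf.1 hℓ.out hℓN hx
  rw [hf.2 ℓ, LFunction_apply_prime_eq_frobeniusTrace W ℓ hgood] at hE
  have hE' : ((W.frobeniusTrace ℓ - (ℓ + 1) : ℤ) : ℂ) * x ∈ periodLatticeGamma1 f := by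
    convert hE using 2
    push_cast
    ring
  exact mem_of_intCast_mul_mem_of_prime_mul_mem hp hnot hE' hpx

/-- Datum form: for every `X₀(N)`-parametrisation datum `D` of `W` and every prime `p` with `W[p]` irreducible,
`ShimuraIndexPrimeTo p D.f`. [cite: Ribet1988Shimura, Thm. 1 and §3] -/
theorem shimuraIndexPrimeTo_datum_of_hasIrreducibleModPGaloisRep (D : ModularParametrizationData W N)
    {p : ℕ} (hp : p.Prime) (hirr : W.HasIrreducibleModPGaloisRep p) : ShimuraIndexPrimeTo p D.f :=
  shimuraIndexPrimeTo_of_hasIrreducibleModPGaloisRep W D.isNewformOf hp hirr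

/-- **`W[p]` irreducible ⟹ the plus index `[Λ₀(f)⁺ : Λ₁(f)⁺]` is prime to `p`** (tree
`plusIndexPrimeTo_of_shimuraIndexPrimeTo`). [cite: Ribet1988Shimura, Thm. 1 and §3] [cite: LingOesterle1991, §1] -/
theorem plusIndexPrimeTo_of_hasIrreducibleModPGaloisRep {f : CuspForm (Gamma0 N) 2} (hf : IsNewformOf W f)
    {p : ℕ} (hp : p.Prime) (hirr : W.HasIrreducibleModPGaloisRep p) : PlusIndexPrimeTo p f :=
  plusIndexPrimeTo_of_shimuraIndexPrimeTo hp f (shimuraIndexPrimeTo_of_hasIrreducibleModPGaloisRep W hf hp hirr)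

/-- Contrapositive, the honest shape of the cusp-lifting laws for a general prime: `p ∣ [Λ₀(f) : Λ₁(f)]` forces
`W[p]` to be a REDUCIBLE `Γ_ℚ`-module (a rational `p`-isogeny; for odd `p` NOT necessarily a rational `p`-torsion
point). [cite: Ribet1988Shimura, Thm. 1 and §3] -/
theorem not_hasIrreducibleModPGaloisRep_of_not_shimuraIndexPrimeTo {f : CuspForm (Gamma0 N) 2}
    (hf : IsNewformOf W f) {p : ℕ} (hp : p.Prime) (hS : ¬ ShimuraIndexPrimeTo p f) :
    ¬ W.HasIrreducibleModPGaloisRep p :=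
  fun hirr ↦ hS (shimuraIndexPrimeTo_of_hasIrreducibleModPGaloisRep W hf hp hirr)

end Irreducible

/-! ### §3. `p = 2`: E-an-128₂ `ShimuraTwoForcesRationalTwoTorsion` IS A THEOREM -/

/-- **E-an-128₂ BY NAME** (`KatoCurve.ShimuraTwoForcesRationalTwoTorsion`, an MEMO-an §69.2‴, typed §5 of
`ShimuraCuspLifting.lean`): for a lattice-optimal `W` (the optimality binder is not used), `2 ∣ [Λ₀(f) : Λ₁(f)]`
forces a rational root of the `2`-division cubic of `W`.  Proof: otherwise `W[2]` is irreducible (tree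
`not_hasIrreducibleModPGaloisRep_two_iff_exists_isRoot_twoTorsionPolynomial`) and §2 applies.
[cite: Ribet1988Shimura, Thm. 1 and §3] [cite: SilvermanAEC2009, III.2.3 and Exercise 3.7(b)] -/
theorem shimuraTwoForcesRationalTwoTorsion_holds : ShimuraTwoForcesRationalTwoTorsion := by
  intro W _ _ N _ D _hopt hS
  by_contra hT
  refine hS (shimuraIndexPrimeTo_of_hasIrreducibleModPGaloisRep W D.isNewformOf Nat.prime_two ?_)
  by_contra hred
  exact hT ((W.not_hasIrreducibleModPGaloisRep_two_iff_exists_isRoot_twoTorsionPolynomial).mp hred)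

section Two

variable (W : WeierstrassCurve ℚ) [W.IsElliptic] [W.IsGloballyMinimal] {N : ℕ} [NeZero N]

/-- No rational `2`-torsion ⟹ `Λ₀(f)/Λ₁(f)` has odd order (every level, every datum; E-an-128₂ contrapositive,
UNCONDITIONAL). [cite: Ribet1988Shimura, Thm. 1 and §3] -/
theorem shimuraIndexPrimeTo_two_of_noRationalTwoTorsion {f : CuspForm (Gamma0 N) 2} (hf : IsNewformOf W f)
    (hT : ∀ e : ℚ, ¬ W.twoTorsionPolynomial.toPoly.IsRoot e) : ShimuraIndexPrimeTo 2 f := by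
  refine shimuraIndexPrimeTo_of_hasIrreducibleModPGaloisRep W hf Nat.prime_two ?_
  by_contra hred
  obtain ⟨e, he⟩ := (W.not_hasIrreducibleModPGaloisRep_two_iff_exists_isRoot_twoTorsionPolynomial).mp hred
  exact hT e he

/-- The leaf's edge `plusIndexPrimeTo_two_of_noRationalTwoTorsion` with its E-an-128₂ hypothesis DISCHARGED:
no rational `2`-torsion ⟹ `PlusIndexPrimeTo 2 D.f`. [cite: Ribet1988Shimura, Thm. 1 and §3] -/
theorem plusIndexPrimeTo_two_of_noRationalTwoTorsion' (D : ModularParametrizationData W N)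
    (hopt : ∀ z ∈ D.L.lattice, ∃ w ∈ periodLattice D.f, z = D.c * w)
    (hT : ∀ e : ℚ, ¬ W.twoTorsionPolynomial.toPoly.IsRoot e) : PlusIndexPrimeTo 2 D.f :=
  plusIndexPrimeTo_two_of_noRationalTwoTorsion shimuraTwoForcesRationalTwoTorsion_holds W D hopt hT

/-- The leaf's composition `twoAdicPolarWitness_of_noRationalTwoTorsion` modulo E-es-66₂ ALONE (E-an-128₂ discharged):
lattice-optimal `W`, `4 ∣ N`, no rational `2`-torsion ⟹ a `2`-adic polar witness. [cite: Ribet1988Shimura, Thm. 1 and §3] -/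
theorem twoAdicPolarWitness_of_noRationalTwoTorsion' (h66 : TwoAdicWitnessOfPlusIndexOdd)
    (D : ModularParametrizationData W N) (hopt : ∀ z ∈ D.L.lattice, ∃ w ∈ periodLattice D.f, z = D.c * w)
    (h4 : 2 ^ 2 ∣ N) (hT : ∀ e : ℚ, ¬ W.twoTorsionPolynomial.toPoly.IsRoot e) : TwoAdicPolarWitness W W D.f :=
  twoAdicPolarWitness_of_noRationalTwoTorsion h66 shimuraTwoForcesRationalTwoTorsion_holds W D hopt h4 hT

/-- **TURNKEY-an-15 with E-an-128₂ discharged** (p3's `not_two_dvd_maninConstant_of_noRationalTwoTorsion` minus its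
`h : ShimuraTwoForcesRationalTwoTorsion` binder): `2 ∤ c` for lattice-optimal `W`, `4 ∣ N`, no cuspidal plus defect
at `2`, no rational `2`-torsion — CONDITIONAL on the named hypotheses `exists_isNewformOf`,
`kato_isIntegral_twistedSymbolSum_two_symbolClosure`, `KatoCurveExists` and E-es-66₂ `TwoAdicWitnessOfPlusIndexOdd`.
[cite: Kato2004Asterisque, Thm. 12.5] -/
theorem not_two_dvd_maninConstant_of_noRationalTwoTorsion'
    (hnf : exists_isNewformOf) (hF : kato_isIntegral_twistedSymbolSum_two_symbolClosure) (hK : KatoCurveExists)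
    (h66 : TwoAdicWitnessOfPlusIndexOdd)
    (D : ModularParametrizationData W N) (hopt : ∀ z ∈ D.L.lattice, ∃ w ∈ periodLattice D.f, z = D.c * w)
    (h4 : 2 ^ 2 ∣ N) (hpd : CuspidalPlusDefectPrimeTo 2 D)
    (hT : ∀ e : ℚ, ¬ W.twoTorsionPolynomial.toPoly.IsRoot e) : ¬ (2 : ℤ) ∣ D.c :=
  not_two_dvd_maninConstant_of_noRationalTwoTorsion hnf hF hK h66 shimuraTwoForcesRationalTwoTorsion_holds
    W D hopt h4 hpd hT

end Two

/-! ### §4. `p = 3`: no rational root of `Ψ₃` ⟹ Shimura index and plus index prime to `3` (every level) -/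

section Three

variable (W : WeierstrassCurve ℚ) [W.IsElliptic] [W.IsGloballyMinimal] {N : ℕ} [NeZero N]

/-- `Ψ₃` without a rational root (⟺ `W[3]` irreducible) ⟹ `3 ∤ [Λ₀(f) : Λ₁(f)]`, every level.
[cite: Ribet1988Shimura, Thm. 1 and §3] [cite: Cremona1997, §3.8 (l = 3)] -/
theorem shimuraIndexPrimeTo_three_of_forall_not_isRoot_Ψ₃ {f : CuspForm (Gamma0 N) 2} (hf : IsNewformOf W f)
    (hΨ : ∀ x₀ : ℚ, ¬ W.Ψ₃.IsRoot x₀) : ShimuraIndexPrimeTo 3 f :=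
  shimuraIndexPrimeTo_of_hasIrreducibleModPGaloisRep W hf Nat.prime_three
    ((W.hasIrreducibleModPGaloisRep_three_iff_forall_not_isRoot_Ψ₃).mpr hΨ)

/-- **The `W[3]`-irreducible part of E-es-67, at every level**: `Ψ₃` without a rational root ⟹
`PlusIndexPrimeTo 3 f`. [cite: Ribet1988Shimura, Thm. 1 and §3] [cite: Cremona1997, §3.8 (l = 3)] -/
theorem plusIndexPrimeTo_three_of_forall_not_isRoot_Ψ₃ {f : CuspForm (Gamma0 N) 2} (hf : IsNewformOf W f)
    (hΨ : ∀ x₀ : ℚ, ¬ W.Ψ₃.IsRoot x₀) : PlusIndexPrimeTo 3 f :=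
  plusIndexPrimeTo_of_shimuraIndexPrimeTo Nat.prime_three f
    (shimuraIndexPrimeTo_three_of_forall_not_isRoot_Ψ₃ W hf hΨ)

/-- With es's E-es-66 `ThreeAdicWitnessOfPlusIndexPrimeToThree` ALONE: lattice-optimal `W`, `9 ∣ N`, `Ψ₃` without a
rational root ⟹ a `3`-adic polar witness (E-es-67 is not needed on the irreducible locus). [cite: Ribet1988Shimura, Thm. 1 and §3] -/
theorem threeAdicPolarWitness_of_forall_not_isRoot_Ψ₃ (h66 : ThreeAdicWitnessOfPlusIndexPrimeToThree)
    (D : ModularParametrizationData W N) (hopt : ∀ z ∈ D.L.lattice, ∃ w ∈ periodLattice D.f, z = D.c * w)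
    (h9 : 3 ^ 2 ∣ N) (hΨ : ∀ x₀ : ℚ, ¬ W.Ψ₃.IsRoot x₀) : ThreeAdicPolarWitness W W D.f :=
  h66 W D hopt h9 (plusIndexPrimeTo_three_of_forall_not_isRoot_Ψ₃ W D.isNewformOf hΨ)

end Three

/-! ### §5. Traceless level: the Shimura cover is TRIVIAL on the irreducible locus (`Λ₁(f) = Λ₀(f)`) -/

section Traceless

variable (W : WeierstrassCurve ℚ) [W.IsElliptic] [W.IsGloballyMinimal] {N : ℕ} [NeZero N]

/-- **`p² ∣ N` and `W[p]` irreducible ⟹ `Λ₁(f) = Λ₀(f)`.**  `a_p(f) = 0` (Atkin–Lehner, tree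
`IsNewform0.cuspCoeff_eq_zero_of_sq_dvd`), so `p·Λ₀(f) ⊆ Λ₁(f)` (Ling–Oesterlé Thm. 6, tree
`pMulLatticeLeGamma1OfTracelessPrime_holds`); and `Λ₀/Λ₁` has no `p`-torsion by §2.
[cite: LingOesterle1991, Thm. 6] [cite: AtkinLehner1970, Thm. 3] [cite: Ribet1988Shimura, Thm. 1 and §3] -/
theorem periodLatticeGamma1_eq_periodLattice_of_sq_dvd_of_hasIrreducibleModPGaloisRep
    {f : CuspForm (Gamma0 N) 2} (hf : IsNewformOf W f) {p : ℕ} (hp : p.Prime) (hpN : p ^ 2 ∣ N)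
    (hirr : W.HasIrreducibleModPGaloisRep p) : periodLatticeGamma1 f = periodLattice f := by
  refine le_antisymm (periodLatticeGamma1_le_periodLattice f) fun z hz ↦ ?_
  exact shimuraIndexPrimeTo_of_hasIrreducibleModPGaloisRep W hf hp hirr z hz
    (pMulLatticeLeGamma1OfTracelessPrime_holds N f hf.1 p hp ((dvd_pow_self p two_ne_zero).trans hpN)
      (hf.1.cuspCoeff_eq_zero_of_sq_dvd hp hpN) z hz)

/-- **`4 ∣ N`, no rational `2`-torsion ⟹ `Λ₁(f) = Λ₀(f)`** (the Shimura cover `E₁ → E₀` of the C2 regime is an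
isomorphism off the rational-`2`-torsion locus). [cite: LingOesterle1991, Thm. 6] [cite: Ribet1988Shimura, Thm. 1 and §3] -/
theorem periodLatticeGamma1_eq_periodLattice_of_four_dvd_of_noRationalTwoTorsion
    {f : CuspForm (Gamma0 N) 2} (hf : IsNewformOf W f) (h4 : 2 ^ 2 ∣ N)
    (hT : ∀ e : ℚ, ¬ W.twoTorsionPolynomial.toPoly.IsRoot e) : periodLatticeGamma1 f = periodLattice f := by
  refine periodLatticeGamma1_eq_periodLattice_of_sq_dvd_of_hasIrreducibleModPGaloisRep W hf Nat.prime_two h4 ?_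
  by_contra hred
  obtain ⟨e, he⟩ := (W.not_hasIrreducibleModPGaloisRep_two_iff_exists_isRoot_twoTorsionPolynomial).mp hred
  exact hT e he

/-- **`9 ∣ N`, `Ψ₃` without a rational root ⟹ `Λ₁(f) = Λ₀(f)`** (the C3 regime).
[cite: LingOesterle1991, Thm. 6] [cite: Ribet1988Shimura, Thm. 1 and §3] -/
theorem periodLatticeGamma1_eq_periodLattice_of_nine_dvd_of_forall_not_isRoot_Ψ₃
    {f : CuspForm (Gamma0 N) 2} (hf : IsNewformOf W f) (h9 : 3 ^ 2 ∣ N)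
    (hΨ : ∀ x₀ : ℚ, ¬ W.Ψ₃.IsRoot x₀) : periodLatticeGamma1 f = periodLattice f :=
  periodLatticeGamma1_eq_periodLattice_of_sq_dvd_of_hasIrreducibleModPGaloisRep W hf Nat.prime_three h9
    ((W.hasIrreducibleModPGaloisRep_three_iff_forall_not_isRoot_Ψ₃).mpr hΨ)

/-- Consequence for the Manin constants (tree `natAbs_maninConstant₀_eq_of_periodLatticeGamma1_eq_periodLattice`):
at a level `p² ∣ N` with `W₀[p]` irreducible, an optimal `X₁(N)`-datum `D₁` (of any globally minimal `W₁`) on the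
SAME newform as a lattice-optimal `X₀(N)`-datum `D₀` of `W₀` has `|c₀| = |c₁|`.
[cite: LingOesterle1991, Thm. 6] [cite: Stevens1989, §2 (shape only)] -/
theorem natAbs_maninConstant₀_eq_of_sq_dvd_of_hasIrreducibleModPGaloisRep
    {W₁ : WeierstrassCurve ℚ} [W₁.IsElliptic] [W₁.IsGloballyMinimal]
    (D₁ : Gamma1ParametrizationData W₁ N) (D₀ : ModularParametrizationData W N) (h₁ : D₁.IsOptimal)
    (h₀ : ∀ z ∈ D₀.L.lattice, ∃ w ∈ periodLattice D₀.f, z = D₀.c * w) (hf : D₁.f = D₀.f)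
    {p : ℕ} (hp : p.Prime) (hpN : p ^ 2 ∣ N) (hirr : W.HasIrreducibleModPGaloisRep p) :
    D₀.maninConstant.natAbs = D₁.maninConstant.natAbs :=
  natAbs_maninConstant₀_eq_of_periodLatticeGamma1_eq_periodLattice D₁ D₀ h₁ h₀ hf
    (periodLatticeGamma1_eq_periodLattice_of_sq_dvd_of_hasIrreducibleModPGaloisRep W D₀.isNewformOf hp hpN hirr)

end Traceless

end Summit.BirchSwinnertonDyer.BirchSwinnertonDyer.Theorems.ManinLocalTwoThree

end
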